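import Summits.NavierStokesRegularity.NavierStokesRegularity.Theorems.TypeICertificateLadderTargetNormalVelocityRung
import HarnessLib

/-!
# Crux `Target` = `TypeICertificateLadder.NoTypeIBlowup` (stmt-NavierStokesRegularity-1217), line
# `depletion-ladder`: THE VORTICITY-SIDE CHANNELS OF ENSTROPHY PRODUCTION, II — only the TRANSVERSAL curl
# `ξ × curl ω` produces enstrophy (Lamb form); the twist `ξ·curl ω` is blind; `R² + τ ≤ 1`

`--supports stmt-NavierStokesRegularity-1217` (helper; kinematics file 2 of 3, independent of file 1 `…ChannelsLongitudinal`).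
Author: STA lineage `ns-sta-19551-p1` (g12).

In the Lamb form `J = ∫⟪v, ω × curl ω⟫` (g6) one has `ω × curl ω = |ω|·(ξ × curl ω)`: the component of `curl ω`
ALONG `ω` — the twist / current-helicity density `ξ·curl ω` (`= |ω| ξ·curl ξ`) — produces no enstrophy:

* `integral_transversalCurlSq_le` — `‖ξ × curl ω‖₂² := ∫‖ω × curl ω‖²/‖ω‖² ≤ ‖curl ω‖₂² − ∫⟪ξ, curl ω⟫²` (Lagrange);
* `abs_integral_stretching_le_transversalCurl` — `|∫J| ≤ M · ‖ω‖₂ · ‖ξ × curl ω‖₂` on the class of `StretchingDepletion`;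
* `sq_integral_stretching_add_twist_le` — **`R² + τ ≤ 1`** with the TWIST FRACTION `τ = ∫⟪ξ, curl ω⟫²/‖∇ω‖₂²`
  (`v ∈ C³`: `‖curl ω‖₂ = ‖∇ω‖₂`). By Cauchy–Schwarz `τ ≥ σ²` for the superhelicity correlation
  `σ = ∫⟪ω, curl ω⟫/(‖ω‖₂‖curl ω‖₂)` of g4's `…TargetDepletionSuperhelicity`, so this sharpens `R² + σ² ≤ 1`: not
  only the GLOBAL helical correlation but the pointwise twist density is pure slack of the depletion constant.

In the Frenet frame of the vortex lines `ξ × curl ω = ∇_⊥|ω| − |ω|κ n` (transversal magnitude gradient and curvature)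
while the longitudinal channel of file I is `∂_ξω = (∂_ξ|ω|)ξ + |ω|κ n`: the two channels share exactly the
curvature term. WHAT THIS IS NOT: no universal constant; kinematics only. [folklore]

References: P. Constantin, Comm. Math. Phys. 129 (1990), (2.9)–(2.11); Majda–Bertozzi (2002) §1.1.
-/

noncomputable section

open Set Filter Topology MeasureTheory
open scoped RealInnerProductSpace ENNReal NNReal ContDiff
open Literature.Analysis.FluidPDE

namespace Summit.NavierStokesRegularity.NavierStokesRegularity.Theorems.DepletionLadder

-- the problem directory repeats the summit name (`NavierStokesRegularity/NavierStokesRegularity`)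
set_option linter.dupNamespace false

open Summit.NavierStokesRegularity.NavierStokesRegularity.Theorems.RungReynoldsOne

namespace Channels

variable {v : (EuclideanSpace ℝ (Fin 3)) → (EuclideanSpace ℝ (Fin 3))}

/-! ## Pointwise algebra (private copies; the public versions live in `…ChannelsLongitudinal`) -/

/-- First coordinate of the cross product. [folklore] -/
private theorem cross_apply_zero_tw (a c : (EuclideanSpace ℝ (Fin 3))) : cross a c 0 = a 1 * c 2 - a 2 * c 1 := by
  simp [cross, cross_apply]

/-- Second coordinate of the cross product. [folklore] -/
private theorem cross_apply_one_tw (a c : (EuclideanSpace ℝ (Fin 3))) : cross a c 1 = a 2 * c 0 - a 0 * c 2 := by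
  simp [cross, cross_apply]

/-- Third coordinate of the cross product. [folklore] -/
private theorem cross_apply_two_tw (a c : (EuclideanSpace ℝ (Fin 3))) : cross a c 2 = a 0 * c 1 - a 1 * c 0 := by
  simp [cross, cross_apply]

/-- The inner product of `ℝ³` in coordinates. [folklore] -/
private theorem inner_fin_three_tw (p q : (EuclideanSpace ℝ (Fin 3))) :
    ⟪p, q⟫ = p 0 * q 0 + p 1 * q 1 + p 2 * q 2 := by
  simp [PiLp.inner_apply, Fin.sum_univ_three, mul_comm]

/-- Lagrange: `‖a × c‖²/‖a‖² ≤ ‖c‖² − ⟪a, c⟫²/‖a‖²` (equality where `a ≠ 0`). [folklore] -/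
private theorem norm_cross_sq_div_le_tw (a c : (EuclideanSpace ℝ (Fin 3))) :
    ‖cross a c‖ ^ 2 / ‖a‖ ^ 2 ≤ ‖c‖ ^ 2 - ⟪a, c⟫ ^ 2 / ‖a‖ ^ 2 := by
  have hlag : ‖cross a c‖ ^ 2 = ‖a‖ ^ 2 * ‖c‖ ^ 2 - ⟪a, c⟫ ^ 2 := by
    rw [← real_inner_self_eq_norm_sq (cross a c), ← real_inner_self_eq_norm_sq a,
      ← real_inner_self_eq_norm_sq c, inner_fin_three_tw, inner_fin_three_tw, inner_fin_three_tw,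
      inner_fin_three_tw, cross_apply_zero_tw, cross_apply_one_tw, cross_apply_two_tw]
    ring
  by_cases ha : a = 0
  · subst ha; simp
  · have h0 : 0 < ‖a‖ ^ 2 := by positivity
    rw [hlag, sub_div, mul_div_cancel_left₀ _ h0.ne']

/-- `‖a × c‖ = ‖a‖ · (‖a × c‖/‖a‖)` (also at `a = 0`). [folklore] -/
private theorem norm_cross_eq_norm_mul_div_tw (a c : (EuclideanSpace ℝ (Fin 3))) :
    ‖cross a c‖ = ‖a‖ * (‖cross a c‖ / ‖a‖) := by
  by_cases ha : a = 0
  · subst ha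
    have : cross (0 : (EuclideanSpace ℝ (Fin 3))) c = 0 := by
      ext i; fin_cases i <;> simp [cross_apply_zero_tw, cross_apply_one_tw, cross_apply_two_tw]
    simp [this]
  · rw [mul_div_cancel₀ _ (norm_ne_zero_iff.2 ha)]

/-! ## Channel 2: the transversal curl `ξ × curl ω` (twist is blind) -/

/-- The transversal-curl density `‖ω × curl ω‖²/‖ω‖² = ‖ξ × curl ω‖²` is integrable with
`∫‖ω × curl ω‖²/‖ω‖² ≤ ∫‖curl ω‖² − ∫⟪ω, curl ω⟫²/‖ω‖²` (Lagrange; the twist density `⟪ξ, curl ω⟫²` is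
subtracted), both parts being integrable. [folklore] -/
theorem integral_transversalCurlSq_le (hv : ContDiff ℝ 2 v)
    (iA : Integrable (fun x => frobeniusNormSq (fderiv ℝ (curl v) x))) :
    Integrable (fun x => ‖cross (curl v x) (curl (curl v) x)‖ ^ 2 / ‖curl v x‖ ^ 2) ∧
    Integrable (fun x => ⟪curl v x, curl (curl v) x⟫ ^ 2 / ‖curl v x‖ ^ 2) ∧
    ∫ x, ‖cross (curl v x) (curl (curl v) x)‖ ^ 2 / ‖curl v x‖ ^ 2 ≤
      (∫ x, ‖curl (curl v) x‖ ^ 2) - ∫ x, ⟪curl v x, curl (curl v) x⟫ ^ 2 / ‖curl v x‖ ^ 2 := by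
  have hw1 : ContDiff ℝ 1 (curl v) := contDiff_one_curl_of_contDiff_two hv
  have cw : Continuous (curl v) := hw1.continuous
  have cc : Continuous (curl (curl v)) := continuous_curl hw1
  have ic2 : Integrable (fun x => ‖curl (curl v) x‖ ^ 2) := integrable_norm_curl_curl_sq hv iA
  have ccross : Continuous fun x => cross (curl v x) (curl (curl v) x) :=
    (crossCLM.continuous.comp cw).clm_apply cc
  -- twist part
  have htw_le : ∀ x, ⟪curl v x, curl (curl v) x⟫ ^ 2 / ‖curl v x‖ ^ 2 ≤ ‖curl (curl v) x‖ ^ 2 := by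
    intro x
    by_cases h0 : curl v x = 0
    · rw [h0]; simp
    · have hp : 0 < ‖curl v x‖ ^ 2 := by positivity
      rw [div_le_iff₀ hp]
      calc ⟪curl v x, curl (curl v) x⟫ ^ 2 = |⟪curl v x, curl (curl v) x⟫| ^ 2 := (sq_abs _).symm
        _ ≤ (‖curl v x‖ * ‖curl (curl v) x‖) ^ 2 :=
            pow_le_pow_left₀ (abs_nonneg _) (abs_real_inner_le_norm _ _) 2
        _ = ‖curl (curl v) x‖ ^ 2 * ‖curl v x‖ ^ 2 := by ring
  have itw : Integrable (fun x => ⟪curl v x, curl (curl v) x⟫ ^ 2 / ‖curl v x‖ ^ 2) := by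
    refine ic2.mono' (((cw.inner cc).pow 2).measurable.div (cw.norm.pow 2).measurable).aestronglyMeasurable
      (Eventually.of_forall fun x => ?_)
    rw [Real.norm_of_nonneg (by positivity)]
    exact htw_le x
  -- transversal part
  have htr_le : ∀ x, ‖cross (curl v x) (curl (curl v) x)‖ ^ 2 / ‖curl v x‖ ^ 2 ≤
      ‖curl (curl v) x‖ ^ 2 - ⟪curl v x, curl (curl v) x⟫ ^ 2 / ‖curl v x‖ ^ 2 := fun x =>
    norm_cross_sq_div_le_tw _ _
  have itr : Integrable (fun x => ‖cross (curl v x) (curl (curl v) x)‖ ^ 2 / ‖curl v x‖ ^ 2) := by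
    refine (ic2.sub itw).mono' ((ccross.norm.pow 2).measurable.div (cw.norm.pow 2).measurable).aestronglyMeasurable
      (Eventually.of_forall fun x => ?_)
    rw [Real.norm_of_nonneg (by positivity)]
    exact htr_le x
  refine ⟨itr, itw, ?_⟩
  rw [← integral_sub ic2 itw]
  exact integral_mono itr (ic2.sub itw) htr_le

/-- **TWIST IS BLIND (kinematics).** On the class of `StretchingDepletion` (`v ∈ C²` divergence free, `|v| ≤ M`,
`ω = curl v ∈ L²`, `|∇ω|_F ∈ L²`, integrable stretching density):
`|∫⟪ω, Dv ω⟫| ≤ M · ‖ω‖₂ · ‖ξ × curl ω‖₂`, `‖ξ × curl ω‖₂² := ∫‖ω × curl ω‖²/‖ω‖²` — the component of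
`curl ω` along `ω` (twist, current-helicity density) produces no enstrophy (Lamb form + Cauchy–Schwarz). [folklore] -/
theorem abs_integral_stretching_le_transversalCurl (hv : ContDiff ℝ 2 v) (hdiv : VectorCalculus.IsDivFree v)
    {M : ℝ} (hM : ∀ x, ‖v x‖ ≤ M)
    (iZ : Integrable (fun x => ‖curl v x‖ ^ 2))
    (iA : Integrable (fun x => frobeniusNormSq (fderiv ℝ (curl v) x)))
    (iJ : Integrable (fun x => ⟪curl v x, fderiv ℝ v x (curl v x)⟫)) :
    |∫ x, ⟪curl v x, fderiv ℝ v x (curl v x)⟫| ≤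
      M * Real.sqrt (∫ x, ‖curl v x‖ ^ 2) *
        Real.sqrt (∫ x, ‖cross (curl v x) (curl (curl v) x)‖ ^ 2 / ‖curl v x‖ ^ 2) := by
  rw [integral_stretching_eq_integral_inner_cross hv hdiv hM iZ iA iJ]
  obtain ⟨itr, -, -⟩ := integral_transversalCurlSq_le hv iA
  have hw1 : ContDiff ℝ 1 (curl v) := contDiff_one_curl_of_contDiff_two hv
  have cw : Continuous (curl v) := hw1.continuous
  have cc : Continuous (curl (curl v)) := continuous_curl hw1
  have ccross : Continuous fun x => cross (curl v x) (curl (curl v) x) :=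
    (crossCLM.continuous.comp cw).clm_apply cc
  have hM0 : 0 ≤ M := (norm_nonneg _).trans (hM 0)
  set g : (EuclideanSpace ℝ (Fin 3)) → ℝ := fun x => ‖cross (curl v x) (curl (curl v) x)‖ / ‖curl v x‖ with hgdef
  have hg0 : ∀ x, 0 ≤ g x := fun x => by positivity
  have hgm : AEStronglyMeasurable g volume :=
    (ccross.norm.measurable.div cw.norm.measurable).aestronglyMeasurable
  have hg2 : Integrable (fun x => g x ^ 2) := by
    refine itr.congr (Eventually.of_forall fun x => ?_)
    simp only [hgdef, div_pow]
  have hpt : ∀ x, |⟪v x, cross (curl v x) (curl (curl v) x)⟫| ≤ M * (‖curl v x‖ * g x) := fun x => by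
    calc |⟪v x, cross (curl v x) (curl (curl v) x)⟫| ≤ ‖v x‖ * ‖cross (curl v x) (curl (curl v) x)‖ :=
          abs_real_inner_le_norm _ _
      _ ≤ M * ‖cross (curl v x) (curl (curl v) x)‖ := mul_le_mul_of_nonneg_right (hM x) (norm_nonneg _)
      _ = M * (‖curl v x‖ * g x) := by rw [hgdef]; simp only; rw [← norm_cross_eq_norm_mul_div_tw]
  have mw : MemLp (fun x => ‖curl v x‖) 2 volume := memLp_two_norm_curl hv iZ
  have mg : MemLp g 2 volume := (memLp_two_iff_integrable_sq hgm).2 hg2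
  have iprod : Integrable (fun x => ‖curl v x‖ * g x) := mw.integrable_mul mg
  have h1 : |∫ x, ⟪v x, cross (curl v x) (curl (curl v) x)⟫| ≤ M * ∫ x, ‖curl v x‖ * g x := by
    rw [← integral_const_mul]
    exact (abs_integral_le_integral_abs).trans (integral_mono_of_nonneg (Eventually.of_forall fun x =>
      abs_nonneg _) (iprod.const_mul M) (Eventually.of_forall hpt))
  have hcs : ∫ x, ‖curl v x‖ * g x ≤
      Real.sqrt (∫ x, ‖curl v x‖ ^ 2) * Real.sqrt (∫ x, g x ^ 2) :=
    integral_mul_le_sqrt_mul_sqrt (μ := volume) (fun x => norm_nonneg _) hg0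
      cw.norm.aestronglyMeasurable hgm iZ hg2
  have hg2eq : ∫ x, g x ^ 2 = ∫ x, ‖cross (curl v x) (curl (curl v) x)‖ ^ 2 / ‖curl v x‖ ^ 2 :=
    integral_congr_ae (Eventually.of_forall fun x => by simp only [hgdef, div_pow])
  calc |∫ x, ⟪v x, cross (curl v x) (curl (curl v) x)⟫| ≤ M * ∫ x, ‖curl v x‖ * g x := h1
    _ ≤ M * (Real.sqrt (∫ x, ‖curl v x‖ ^ 2) * Real.sqrt (∫ x, g x ^ 2)) :=
        mul_le_mul_of_nonneg_left hcs hM0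
    _ = _ := by rw [hg2eq]; ring

/-- **`R² + τ ≤ 1`: the twist law in S1's normalisation.** For `v ∈ C³(ℝ³; ℝ³)` divergence free, bounded by `M`,
with `ω = curl v ∈ L²`, `|∇ω|_F ∈ L²` and integrable stretching density:
`(∫⟪ω, Dv ω⟫)² + M²‖ω‖₂² ∫⟪ω, curl ω⟫²/‖ω‖² ≤ M² ‖ω‖₂² ‖∇ω‖₂²`, i.e. with the TWIST FRACTION
`τ := ∫(⟪ξ, curl ω⟫²)/‖∇ω‖₂² ∈ [0,1]`: `R² + τ ≤ 1`. Since `(∫⟪ω, curl ω⟫)² ≤ ‖ω‖₂² ∫⟪ξ, curl ω⟫²`, `τ ≥ σ²` for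
the superhelicity correlation `σ` of `…TargetDepletionSuperhelicity` (`R² + σ² ≤ 1` is the weaker law). [folklore] -/
theorem sq_integral_stretching_add_twist_le (hv : ContDiff ℝ 3 v) (hdiv : VectorCalculus.IsDivFree v)
    {M : ℝ} (hM : ∀ x, ‖v x‖ ≤ M)
    (iZ : Integrable (fun x => ‖curl v x‖ ^ 2))
    (iA : Integrable (fun x => frobeniusNormSq (fderiv ℝ (curl v) x)))
    (iJ : Integrable (fun x => ⟪curl v x, fderiv ℝ v x (curl v x)⟫)) :
    (∫ x, ⟪curl v x, fderiv ℝ v x (curl v x)⟫) ^ 2 +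
        M ^ 2 * (∫ x, ‖curl v x‖ ^ 2) * ∫ x, ⟪curl v x, curl (curl v) x⟫ ^ 2 / ‖curl v x‖ ^ 2 ≤
      M ^ 2 * (∫ x, ‖curl v x‖ ^ 2) * ∫ x, frobeniusNormSq (fderiv ℝ (curl v) x) := by
  have hv2 : ContDiff ℝ 2 v := hv.of_le (by norm_num)
  have h := abs_integral_stretching_le_transversalCurl hv2 hdiv hM iZ iA iJ
  obtain ⟨itr, itw, hle⟩ := integral_transversalCurlSq_le hv2 iA
  rw [integral_norm_curl_curl_sq_eq hv iZ iA] at hle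
  have hZ0 : 0 ≤ ∫ x, ‖curl v x‖ ^ 2 := integral_nonneg fun x => by positivity
  have hX0 : 0 ≤ ∫ x, ‖cross (curl v x) (curl (curl v) x)‖ ^ 2 / ‖curl v x‖ ^ 2 :=
    integral_nonneg fun x => by positivity
  have hM0 : 0 ≤ M := (norm_nonneg _).trans (hM 0)
  have hsq : (∫ x, ⟪curl v x, fderiv ℝ v x (curl v x)⟫) ^ 2 ≤
      M ^ 2 * (∫ x, ‖curl v x‖ ^ 2) * ∫ x, ‖cross (curl v x) (curl (curl v) x)‖ ^ 2 / ‖curl v x‖ ^ 2 := by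
    calc (∫ x, ⟪curl v x, fderiv ℝ v x (curl v x)⟫) ^ 2
        = |∫ x, ⟪curl v x, fderiv ℝ v x (curl v x)⟫| ^ 2 := (sq_abs _).symm
      _ ≤ (M * Real.sqrt (∫ x, ‖curl v x‖ ^ 2) *
            Real.sqrt (∫ x, ‖cross (curl v x) (curl (curl v) x)‖ ^ 2 / ‖curl v x‖ ^ 2)) ^ 2 :=
          pow_le_pow_left₀ (abs_nonneg _) h 2
      _ = _ := by rw [mul_pow, mul_pow, Real.sq_sqrt hZ0, Real.sq_sqrt hX0]
  have hMZ : 0 ≤ M ^ 2 * ∫ x, ‖curl v x‖ ^ 2 := by positivity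
  nlinarith [mul_le_mul_of_nonneg_left hle hMZ]


end Channels

end Summit.NavierStokesRegularity.NavierStokesRegularity.Theorems.DepletionLadder

end
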